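import Summits.ResolutionOfSingularities.ResolutionOfSingularities.Theorems.FrobeniusLadderFInjectiveMacaulayficationClosedCentreRungs
import Summits.ResolutionOfSingularities.ResolutionOfSingularities.Theorems.FrobeniusLadderFInjectiveMacaulayficationFCUnguardedLocDimLe3
import Summits.ResolutionOfSingularities.ResolutionOfSingularities.Theorems.FrobeniusLadderFInjectiveMacaulayficationFCUnguardedDimFourOfAbsorbingStep
import HarnessLib.Audit
import HarnessLib

/-!
# THE d = 4 / d ≥ 5 SPLIT of the three research stubs of door v34 (`ClosedCentreExistsDimGe4`, `FCUnguardedLocDimLe3`, `FCUnguardedLocDimGe4`)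
# (crux `FInjectiveMacaulayfication` stmt-ResolutionOfSingularities-15315, chain w45a; res-L1-w45a-plan-1 RULING R17.1 §2 (α) — door v35 = v34 with every
# dimension binder raised to `5 ≤ topologicalKrullDim X₁` plus the ONE dim-4 local residue (L4) `LocalFullificationDimFour`; seat res-L1-w45a-stub-1 g7)

[OURS · L1 W4.5a] Support file (`--supports stmt-ResolutionOfSingularities-15315 --as helper`); replaces the role of NO printed item — door bookkeeping of
OURS; NOT a statement of the manuscript; definition lane (five `def … : Prop`, statements only, tagged as their v34 parents); AI-written (AI review is
weaker than expert review).

THE FIVE STATEMENTS are the texts of the three v34 research stubs VERBATIM with the single binder `4 ≤ topologicalKrullDim X₁ →` replaced: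
* `ClosedCentreExistsDimEq4` / `ClosedCentreExistsDimGe5` := `ClosedCentreRungs.ClosedCentreExistsDimGe4` with `topologicalKrullDim X₁ = 4 →` /
  `5 ≤ topologicalKrullDim X₁ →`;
* `FCUnguardedLocDimLe3DimEq4` / `FCUnguardedLocDimLe3DimGe5` := `FCUnguardedLocDimLe3.FCUnguardedLocDimLe3`, same substitution;
* `FCUnguardedLocDimGe4DimGe5` := `FCUnguardedAprime.FCUnguardedLocDimGe4` with `5 ≤ topologicalKrullDim X₁ →` (its `= 4` slice is VACUOUS: a point of
  local dimension `≥ 4` of a scheme of dimension `≤ 4` is closed, `FCUnguardedDimFourOfAbsorbingStep.isClosed_singleton_of_le_ringKrullDim_stalk`).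
THE SPLITTERS (pure logic + `dim_eq4_or_ge5 : 4 ≤ d → d = 4 ∨ 5 ≤ d` in `WithBot ℕ∞`):
* `closedCentreExistsDimGe4_of_eq4_ge5 : ClosedCentreExistsDimEq4 → ClosedCentreExistsDimGe5 → ClosedCentreRungs.ClosedCentreExistsDimGe4`;
* `fcUnguardedLocDimLe3_of_eq4_ge5 : FCUnguardedLocDimLe3DimEq4 → FCUnguardedLocDimLe3DimGe5 → FCUnguardedLocDimLe3.FCUnguardedLocDimLe3`;
* `fcUnguardedLocDimGe4_of_ge5 : FCUnguardedLocDimGe4DimGe5 → FCUnguardedAprime.FCUnguardedLocDimGe4`;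
and the converse weakenings `…_of_dimGe4` (each new statement is implied by its v34 parent — an honest case split). The `= 4` slices are the targets
of res-L1-w45a-stub-3's (β)/(γ) `…DimFourCoresOfL4` (theorems modulo {CP 1.1, 081R, CP 4.4} ∧ (L4)); the `≥ 5` ones are door v35's registered residue.
[folklore plumbing; no named fact is asserted]
-/

-- single-problem summit: the doubled namespace component is forced
set_option linter.dupNamespace false
set_option autoImplicit false

noncomputable section

open CategoryTheory AlgebraicGeometry IsLocalRing
open Literature.AlgebraicGeometry.Resolution

namespace Summit.ResolutionOfSingularities.ResolutionOfSingularities.Theorems.FInjectiveMacaulayfication.DimSplitFive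

open Summit.ResolutionOfSingularities.ResolutionOfSingularities.Theorems.FInjectiveMacaulayfication

/-! ## §0 The dimension dichotomy -/

/-- `4 ≤ d` in `WithBot ℕ∞` splits as `d = 4` or `5 ≤ d`. [plumbing] -/
theorem dim_eq4_or_ge5 (d : WithBot ℕ∞) (h : 4 ≤ d) : d = 4 ∨ 5 ≤ d := by
  induction d using WithBot.recBotCoe with
  | bot => exact absurd h (by simp)
  | coe a =>
    induction a using ENat.recTopCoe with
    | top =>
      refine Or.inr ?_
      rw [← WithBot.coe_ofNat, WithBot.coe_le_coe]; exact le_top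
    | coe n =>
      have hn : 4 ≤ n := by
        rw [← WithBot.coe_ofNat, WithBot.coe_le_coe] at h
        exact_mod_cast h
      rcases Nat.lt_or_ge n 5 with h' | h'
      · refine Or.inl ?_
        have : n = 4 := by omega
        subst this
        rfl
      · refine Or.inr ?_
        rw [← WithBot.coe_ofNat, WithBot.coe_le_coe]
        exact_mod_cast h'

/-- `d = 4` implies `4 ≤ d`. [plumbing] -/
theorem four_le_of_eq4 {d : WithBot ℕ∞} (h : d = 4) : 4 ≤ d := h ▸ le_rfl

/-- `5 ≤ d` implies `4 ≤ d`. [plumbing] -/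
theorem four_le_of_five_le {d : WithBot ℕ∞} (h : 5 ≤ d) : 4 ≤ d :=
  le_trans (by norm_num : (4 : WithBot ℕ∞) ≤ 5) h

/-! ## §1 #4β (closed centre) in dimension `= 4` and `≥ 5` -/

/-- [OURS · candidate statement] **#4β in dimension `= 4`** — `ClosedCentreRungs.ClosedCentreExistsDimGe4` VERBATIM with `topologicalKrullDim X₁ = 4`:
the d = 4 closed-point core; a THEOREM modulo {CP 2019 Thm. 1.1, Raynaud–Gruson, CP 2019 Prop. 4.4} ∧ (L4) `LocalFullificationDimFour` (res-L1-w45a-stub-3's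
`…DimFourCoresOfL4`). [candidate statement, OURS] -/
@[conjecture] def ClosedCentreExistsDimEq4 : Prop :=
    ∀ (p : ℕ), p.Prime → ∀ (k : Type) [Field k] [CharP k p] (X₁ : Scheme.{0}) (f₁ : X₁ ⟶ Spec (.of k)),
    IsSeparated f₁ → LocallyOfFiniteType f₁ → QuasiCompact f₁ → IsIntegral X₁ → topologicalKrullDim X₁ = 4 →
    (∀ x : X₁, ∀ d : ℕ, ringKrullDim (X₁.presheaf.stalk x) = d → ∀ s : Fin d → X₁.presheaf.stalk x, (Ideal.span (Set.range s)).radical.IsMaximal → RingTheory.Sequence.IsWeaklyRegular (X₁.presheaf.stalk x) (List.ofFn s)) →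
    Set.Finite {x : X₁ | ¬ ∀ d : ℕ, ringKrullDim (X₁.presheaf.stalk x) = d → ∀ s : Fin d → X₁.presheaf.stalk x, (Ideal.span (Set.range s)).radical.IsMaximal → ∀ y : X₁.presheaf.stalk x, (∃ e : ℕ, y ^ p ^ e ∈ Ideal.span ((fun z : X₁.presheaf.stalk x => z ^ p ^ e) '' (Ideal.span (Set.range s) : Set (X₁.presheaf.stalk x)))) → y ∈ Ideal.span (Set.range s)} →
    ∀ b : X₁, IsClosed ({b} : Set X₁) → (¬ ∀ d : ℕ, ringKrullDim (X₁.presheaf.stalk b) = d → ∀ s : Fin d → X₁.presheaf.stalk b, (Ideal.span (Set.range s)).radical.IsMaximal → ∀ y : X₁.presheaf.stalk b, (∃ e : ℕ, y ^ p ^ e ∈ Ideal.span ((fun z : X₁.presheaf.stalk b => z ^ p ^ e) '' (Ideal.span (Set.range s) : Set (X₁.presheaf.stalk b)))) → y ∈ Ideal.span (Set.range s)) →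
      ∃ J : X₁.IdealSheafData, J ≠ ⊥ ∧ b ∈ (J.support : Set X₁) ∧
        ∀ (X' : Scheme.{0}) (π : X' ⟶ X₁), Literature.AlgebraicGeometry.Resolution.IsBlowup π J →
          ∀ x' : X', π.base x' ∈ (J.support : Set X₁) → IsDomain (X'.presheaf.stalk x') ∧ ∀ d : ℕ, ringKrullDim (X'.presheaf.stalk x') = d → ∀ s : Fin d → X'.presheaf.stalk x', (Ideal.span (Set.range s)).radical.IsMaximal → RingTheory.Sequence.IsWeaklyRegular (X'.presheaf.stalk x') (List.ofFn s) ∧ ∀ y : X'.presheaf.stalk x', (∃ e : ℕ, y ^ p ^ e ∈ Ideal.span ((fun z : X'.presheaf.stalk x' => z ^ p ^ e) '' (Ideal.span (Set.range s) : Set (X'.presheaf.stalk x')))) → y ∈ Ideal.span (Set.range s)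

/-- [OURS · candidate statement, the RESIDUAL] **#4β in dimension `≥ 5`** — `ClosedCentreRungs.ClosedCentreExistsDimGe4` VERBATIM with
`5 ≤ topologicalKrullDim X₁`: door v35's registered closed-point residue (the crux core in dimension ≥ 5). [candidate statement, OURS; residual] -/
@[conjecture] def ClosedCentreExistsDimGe5 : Prop :=
    ∀ (p : ℕ), p.Prime → ∀ (k : Type) [Field k] [CharP k p] (X₁ : Scheme.{0}) (f₁ : X₁ ⟶ Spec (.of k)),
    IsSeparated f₁ → LocallyOfFiniteType f₁ → QuasiCompact f₁ → IsIntegral X₁ → 5 ≤ topologicalKrullDim X₁ →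
    (∀ x : X₁, ∀ d : ℕ, ringKrullDim (X₁.presheaf.stalk x) = d → ∀ s : Fin d → X₁.presheaf.stalk x, (Ideal.span (Set.range s)).radical.IsMaximal → RingTheory.Sequence.IsWeaklyRegular (X₁.presheaf.stalk x) (List.ofFn s)) →
    Set.Finite {x : X₁ | ¬ ∀ d : ℕ, ringKrullDim (X₁.presheaf.stalk x) = d → ∀ s : Fin d → X₁.presheaf.stalk x, (Ideal.span (Set.range s)).radical.IsMaximal → ∀ y : X₁.presheaf.stalk x, (∃ e : ℕ, y ^ p ^ e ∈ Ideal.span ((fun z : X₁.presheaf.stalk x => z ^ p ^ e) '' (Ideal.span (Set.range s) : Set (X₁.presheaf.stalk x)))) → y ∈ Ideal.span (Set.range s)} →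
    ∀ b : X₁, IsClosed ({b} : Set X₁) → (¬ ∀ d : ℕ, ringKrullDim (X₁.presheaf.stalk b) = d → ∀ s : Fin d → X₁.presheaf.stalk b, (Ideal.span (Set.range s)).radical.IsMaximal → ∀ y : X₁.presheaf.stalk b, (∃ e : ℕ, y ^ p ^ e ∈ Ideal.span ((fun z : X₁.presheaf.stalk b => z ^ p ^ e) '' (Ideal.span (Set.range s) : Set (X₁.presheaf.stalk b)))) → y ∈ Ideal.span (Set.range s)) →
      ∃ J : X₁.IdealSheafData, J ≠ ⊥ ∧ b ∈ (J.support : Set X₁) ∧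
        ∀ (X' : Scheme.{0}) (π : X' ⟶ X₁), Literature.AlgebraicGeometry.Resolution.IsBlowup π J →
          ∀ x' : X', π.base x' ∈ (J.support : Set X₁) → IsDomain (X'.presheaf.stalk x') ∧ ∀ d : ℕ, ringKrullDim (X'.presheaf.stalk x') = d → ∀ s : Fin d → X'.presheaf.stalk x', (Ideal.span (Set.range s)).radical.IsMaximal → RingTheory.Sequence.IsWeaklyRegular (X'.presheaf.stalk x') (List.ofFn s) ∧ ∀ y : X'.presheaf.stalk x', (∃ e : ℕ, y ^ p ^ e ∈ Ideal.span ((fun z : X'.presheaf.stalk x' => z ^ p ^ e) '' (Ideal.span (Set.range s) : Set (X'.presheaf.stalk x')))) → y ∈ Ideal.span (Set.range s)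

/-! ## §2 FC″ at non-closed bad points of local dimension `≤ 3`, in dimension `= 4` and `≥ 5` -/

/-- [OURS · candidate statement] **FC″(loc dim ≤ 3) in dimension `= 4`** — `FCUnguardedLocDimLe3.FCUnguardedLocDimLe3` VERBATIM with
`topologicalKrullDim X₁ = 4`: a THEOREM modulo {CP 1.1, 081R, CP 4.4} ∧ (L4) (res-L1-w45a-stub-3's `…DimFourCoresOfL4`; cf. the tree's
`FCUnguardedDimFourOfAbsorbingStep` route via (T3ᵃ′)). [candidate statement, OURS] -/
@[conjecture] def FCUnguardedLocDimLe3DimEq4 : Prop :=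
  ∀ (p : ℕ), p.Prime → ∀ (k : Type) [Field k] [CharP k p]
    (X₁ : Scheme.{0}) (f₁ : X₁ ⟶ Spec (.of k)),
      IsSeparated f₁ → LocallyOfFiniteType f₁ → QuasiCompact f₁ → IsIntegral X₁ → topologicalKrullDim X₁ = 4 →
      (∀ x : X₁, (∀ d : ℕ, ringKrullDim (X₁.presheaf.stalk x) = d → ∀ s : Fin d → X₁.presheaf.stalk x,
        (Ideal.span (Set.range s)).radical.IsMaximal → RingTheory.Sequence.IsWeaklyRegular (X₁.presheaf.stalk x) (List.ofFn s))) →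
      ∀ η : X₁, (¬ IsClosed ({η} : Set X₁) ∧ ¬ (∀ d : ℕ, ringKrullDim (X₁.presheaf.stalk η) = d → ∀ s : Fin d → X₁.presheaf.stalk η,
          (Ideal.span (Set.range s)).radical.IsMaximal → ∀ t : X₁.presheaf.stalk η, (∃ e : ℕ, t ^ p ^ e ∈
            Ideal.span ((fun z : X₁.presheaf.stalk η => z ^ p ^ e) '' (Ideal.span (Set.range s) : Set (X₁.presheaf.stalk η)))) →
              t ∈ Ideal.span (Set.range s)) ∧
        ∀ y : X₁, y ⤳ η → y ≠ η → (∀ d : ℕ, ringKrullDim (X₁.presheaf.stalk y) = d → ∀ s : Fin d → X₁.presheaf.stalk y,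
          (Ideal.span (Set.range s)).radical.IsMaximal → ∀ t : X₁.presheaf.stalk y, (∃ e : ℕ, t ^ p ^ e ∈
            Ideal.span ((fun z : X₁.presheaf.stalk y => z ^ p ^ e) '' (Ideal.span (Set.range s) : Set (X₁.presheaf.stalk y)))) →
              t ∈ Ideal.span (Set.range s))) →
      -- local dimension ≤ 3 at η (R16.19/R16.21: ONE mechanism for all local dimensions ≤ 3; ≥ 4 is the d ≥ 5 residual `FCUnguardedLocDimGe4`)
      ringKrullDim (X₁.presheaf.stalk η) ≤ 3 →
      ∃ (J : X₁.IdealSheafData) (n' : ℕ) (c' : Fin n' → X₁.presheaf.stalk η), J ≠ ⊥ ∧ η ∈ (J.support : Set X₁) ∧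
      -- the RE-CHOSEN LocFix datum c' at η (currency (A′)): nonzero, inside 𝔪_η, charts FULL over 𝔪_η
      Ideal.span (Set.range c') ≠ ⊥ ∧ Ideal.span (Set.range c') ≤ maximalIdeal (X₁.presheaf.stalk η) ∧
        (∀ (j : Fin n') (𝔔 : PrimeSpectrum (blowupAlgebra (Ideal.span (Set.range c')) (c' j))),
          𝔔.asIdeal.comap (algebraMap (X₁.presheaf.stalk η) (blowupAlgebra (Ideal.span (Set.range c')) (c' j))) =
            maximalIdeal (X₁.presheaf.stalk η) →
          IsDomain (Localization.AtPrime 𝔔.asIdeal) ∧ ∀ d : ℕ, ringKrullDim (Localization.AtPrime 𝔔.asIdeal) = d →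
            ∀ s : Fin d → Localization.AtPrime 𝔔.asIdeal, (Ideal.span (Set.range s)).radical.IsMaximal →
              RingTheory.Sequence.IsWeaklyRegular (Localization.AtPrime 𝔔.asIdeal) (List.ofFn s) ∧
              ∀ y : Localization.AtPrime 𝔔.asIdeal, (∃ e : ℕ, y ^ p ^ e ∈ Ideal.span ((fun z : Localization.AtPrime 𝔔.asIdeal => z ^ p ^ e) ''
                (Ideal.span (Set.range s) : Set (Localization.AtPrime 𝔔.asIdeal)))) → y ∈ Ideal.span (Set.range s)) ∧
      stalkIdeal J η = Ideal.span (Set.range c') ∧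
      (∀ (X₂ : Scheme.{0}) (π : X₂ ⟶ X₁), IsBlowup π J →
        (∀ x : X₂, π.base x ∈ (J.support : Set X₁) → π.base x ≠ η → ¬ IsClosed ({x} : Set X₂) →
          IsDomain (X₂.presheaf.stalk x) ∧ ∀ d : ℕ, ringKrullDim (X₂.presheaf.stalk x) = d → ∀ s : Fin d → X₂.presheaf.stalk x,
            (Ideal.span (Set.range s)).radical.IsMaximal → RingTheory.Sequence.IsWeaklyRegular (X₂.presheaf.stalk x) (List.ofFn s) ∧
            ∀ t : X₂.presheaf.stalk x, (∃ e : ℕ, t ^ p ^ e ∈ Ideal.span ((fun z : X₂.presheaf.stalk x => z ^ p ^ e) ''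
              (Ideal.span (Set.range s) : Set (X₂.presheaf.stalk x)))) → t ∈ Ideal.span (Set.range s)) ∧
        (∀ x : X₂, π.base x ∈ (J.support : Set X₁) → IsClosed ({x} : Set X₂) →
          ∀ d : ℕ, ringKrullDim (X₂.presheaf.stalk x) = d → ∀ s : Fin d → X₂.presheaf.stalk x,
            (Ideal.span (Set.range s)).radical.IsMaximal → RingTheory.Sequence.IsWeaklyRegular (X₂.presheaf.stalk x) (List.ofFn s)))

/-- [OURS · candidate statement, the RESIDUAL] **FC″(loc dim ≤ 3) in dimension `≥ 5`** — `FCUnguardedLocDimLe3.FCUnguardedLocDimLe3` VERBATIM with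
`5 ≤ topologicalKrullDim X₁`: door v35's registered non-closed residue at local dimension ≤ 3. [candidate statement, OURS; residual] -/
@[conjecture] def FCUnguardedLocDimLe3DimGe5 : Prop :=
  ∀ (p : ℕ), p.Prime → ∀ (k : Type) [Field k] [CharP k p]
    (X₁ : Scheme.{0}) (f₁ : X₁ ⟶ Spec (.of k)),
      IsSeparated f₁ → LocallyOfFiniteType f₁ → QuasiCompact f₁ → IsIntegral X₁ → 5 ≤ topologicalKrullDim X₁ →
      (∀ x : X₁, (∀ d : ℕ, ringKrullDim (X₁.presheaf.stalk x) = d → ∀ s : Fin d → X₁.presheaf.stalk x,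
        (Ideal.span (Set.range s)).radical.IsMaximal → RingTheory.Sequence.IsWeaklyRegular (X₁.presheaf.stalk x) (List.ofFn s))) →
      ∀ η : X₁, (¬ IsClosed ({η} : Set X₁) ∧ ¬ (∀ d : ℕ, ringKrullDim (X₁.presheaf.stalk η) = d → ∀ s : Fin d → X₁.presheaf.stalk η,
          (Ideal.span (Set.range s)).radical.IsMaximal → ∀ t : X₁.presheaf.stalk η, (∃ e : ℕ, t ^ p ^ e ∈
            Ideal.span ((fun z : X₁.presheaf.stalk η => z ^ p ^ e) '' (Ideal.span (Set.range s) : Set (X₁.presheaf.stalk η)))) →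
              t ∈ Ideal.span (Set.range s)) ∧
        ∀ y : X₁, y ⤳ η → y ≠ η → (∀ d : ℕ, ringKrullDim (X₁.presheaf.stalk y) = d → ∀ s : Fin d → X₁.presheaf.stalk y,
          (Ideal.span (Set.range s)).radical.IsMaximal → ∀ t : X₁.presheaf.stalk y, (∃ e : ℕ, t ^ p ^ e ∈
            Ideal.span ((fun z : X₁.presheaf.stalk y => z ^ p ^ e) '' (Ideal.span (Set.range s) : Set (X₁.presheaf.stalk y)))) →
              t ∈ Ideal.span (Set.range s))) →
      -- local dimension ≤ 3 at η (R16.19/R16.21: ONE mechanism for all local dimensions ≤ 3; ≥ 4 is the d ≥ 5 residual `FCUnguardedLocDimGe4`)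
      ringKrullDim (X₁.presheaf.stalk η) ≤ 3 →
      ∃ (J : X₁.IdealSheafData) (n' : ℕ) (c' : Fin n' → X₁.presheaf.stalk η), J ≠ ⊥ ∧ η ∈ (J.support : Set X₁) ∧
      -- the RE-CHOSEN LocFix datum c' at η (currency (A′)): nonzero, inside 𝔪_η, charts FULL over 𝔪_η
      Ideal.span (Set.range c') ≠ ⊥ ∧ Ideal.span (Set.range c') ≤ maximalIdeal (X₁.presheaf.stalk η) ∧
        (∀ (j : Fin n') (𝔔 : PrimeSpectrum (blowupAlgebra (Ideal.span (Set.range c')) (c' j))),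
          𝔔.asIdeal.comap (algebraMap (X₁.presheaf.stalk η) (blowupAlgebra (Ideal.span (Set.range c')) (c' j))) =
            maximalIdeal (X₁.presheaf.stalk η) →
          IsDomain (Localization.AtPrime 𝔔.asIdeal) ∧ ∀ d : ℕ, ringKrullDim (Localization.AtPrime 𝔔.asIdeal) = d →
            ∀ s : Fin d → Localization.AtPrime 𝔔.asIdeal, (Ideal.span (Set.range s)).radical.IsMaximal →
              RingTheory.Sequence.IsWeaklyRegular (Localization.AtPrime 𝔔.asIdeal) (List.ofFn s) ∧
              ∀ y : Localization.AtPrime 𝔔.asIdeal, (∃ e : ℕ, y ^ p ^ e ∈ Ideal.span ((fun z : Localization.AtPrime 𝔔.asIdeal => z ^ p ^ e) ''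
                (Ideal.span (Set.range s) : Set (Localization.AtPrime 𝔔.asIdeal)))) → y ∈ Ideal.span (Set.range s)) ∧
      stalkIdeal J η = Ideal.span (Set.range c') ∧
      (∀ (X₂ : Scheme.{0}) (π : X₂ ⟶ X₁), IsBlowup π J →
        (∀ x : X₂, π.base x ∈ (J.support : Set X₁) → π.base x ≠ η → ¬ IsClosed ({x} : Set X₂) →
          IsDomain (X₂.presheaf.stalk x) ∧ ∀ d : ℕ, ringKrullDim (X₂.presheaf.stalk x) = d → ∀ s : Fin d → X₂.presheaf.stalk x,
            (Ideal.span (Set.range s)).radical.IsMaximal → RingTheory.Sequence.IsWeaklyRegular (X₂.presheaf.stalk x) (List.ofFn s) ∧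
            ∀ t : X₂.presheaf.stalk x, (∃ e : ℕ, t ^ p ^ e ∈ Ideal.span ((fun z : X₂.presheaf.stalk x => z ^ p ^ e) ''
              (Ideal.span (Set.range s) : Set (X₂.presheaf.stalk x)))) → t ∈ Ideal.span (Set.range s)) ∧
        (∀ x : X₂, π.base x ∈ (J.support : Set X₁) → IsClosed ({x} : Set X₂) →
          ∀ d : ℕ, ringKrullDim (X₂.presheaf.stalk x) = d → ∀ s : Fin d → X₂.presheaf.stalk x,
            (Ideal.span (Set.range s)).radical.IsMaximal → RingTheory.Sequence.IsWeaklyRegular (X₂.presheaf.stalk x) (List.ofFn s)))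

/-! ## §3 FC″ at non-closed bad points of local dimension `≥ 4`, in dimension `≥ 5` (the `= 4` slice is vacuous) -/

/-- [OURS · candidate statement, the RESIDUAL] **FC″(loc dim ≥ 4) in dimension `≥ 5`** — `FCUnguardedAprime.FCUnguardedLocDimGe4` VERBATIM with
`5 ≤ topologicalKrullDim X₁` (on a scheme of dimension `4` a point of local dimension `≥ 4` is closed, so the `= 4` slice is empty).
[candidate statement, OURS; residual] -/
@[conjecture] def FCUnguardedLocDimGe4DimGe5 : Prop :=
  ∀ (p : ℕ), p.Prime → ∀ (k : Type) [Field k] [CharP k p]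
    (X₁ : Scheme.{0}) (f₁ : X₁ ⟶ Spec (.of k)),
      IsSeparated f₁ → LocallyOfFiniteType f₁ → QuasiCompact f₁ → IsIntegral X₁ → 5 ≤ topologicalKrullDim X₁ →
      (∀ x : X₁, (∀ d : ℕ, ringKrullDim (X₁.presheaf.stalk x) = d → ∀ s : Fin d → X₁.presheaf.stalk x,
        (Ideal.span (Set.range s)).radical.IsMaximal → RingTheory.Sequence.IsWeaklyRegular (X₁.presheaf.stalk x) (List.ofFn s))) →
      ∀ η : X₁, (¬ IsClosed ({η} : Set X₁) ∧ ¬ (∀ d : ℕ, ringKrullDim (X₁.presheaf.stalk η) = d → ∀ s : Fin d → X₁.presheaf.stalk η,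
          (Ideal.span (Set.range s)).radical.IsMaximal → ∀ t : X₁.presheaf.stalk η, (∃ e : ℕ, t ^ p ^ e ∈
            Ideal.span ((fun z : X₁.presheaf.stalk η => z ^ p ^ e) '' (Ideal.span (Set.range s) : Set (X₁.presheaf.stalk η)))) →
              t ∈ Ideal.span (Set.range s)) ∧
        ∀ y : X₁, y ⤳ η → y ≠ η → (∀ d : ℕ, ringKrullDim (X₁.presheaf.stalk y) = d → ∀ s : Fin d → X₁.presheaf.stalk y,
          (Ideal.span (Set.range s)).radical.IsMaximal → ∀ t : X₁.presheaf.stalk y, (∃ e : ℕ, t ^ p ^ e ∈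
            Ideal.span ((fun z : X₁.presheaf.stalk y => z ^ p ^ e) '' (Ideal.span (Set.range s) : Set (X₁.presheaf.stalk y)))) →
              t ∈ Ideal.span (Set.range s))) →
      -- local dimension ≥ 4 at η (only possible when dim X₁ ≥ 5)
      4 ≤ ringKrullDim (X₁.presheaf.stalk η) →
      ∃ (J : X₁.IdealSheafData) (n' : ℕ) (c' : Fin n' → X₁.presheaf.stalk η), J ≠ ⊥ ∧ η ∈ (J.support : Set X₁) ∧
      Ideal.span (Set.range c') ≠ ⊥ ∧ Ideal.span (Set.range c') ≤ maximalIdeal (X₁.presheaf.stalk η) ∧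
        (∀ (j : Fin n') (𝔔 : PrimeSpectrum (blowupAlgebra (Ideal.span (Set.range c')) (c' j))),
          𝔔.asIdeal.comap (algebraMap (X₁.presheaf.stalk η) (blowupAlgebra (Ideal.span (Set.range c')) (c' j))) =
            maximalIdeal (X₁.presheaf.stalk η) →
          IsDomain (Localization.AtPrime 𝔔.asIdeal) ∧ ∀ d : ℕ, ringKrullDim (Localization.AtPrime 𝔔.asIdeal) = d →
            ∀ s : Fin d → Localization.AtPrime 𝔔.asIdeal, (Ideal.span (Set.range s)).radical.IsMaximal →
              RingTheory.Sequence.IsWeaklyRegular (Localization.AtPrime 𝔔.asIdeal) (List.ofFn s) ∧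
              ∀ y : Localization.AtPrime 𝔔.asIdeal, (∃ e : ℕ, y ^ p ^ e ∈ Ideal.span ((fun z : Localization.AtPrime 𝔔.asIdeal => z ^ p ^ e) ''
                (Ideal.span (Set.range s) : Set (Localization.AtPrime 𝔔.asIdeal)))) → y ∈ Ideal.span (Set.range s)) ∧
      stalkIdeal J η = Ideal.span (Set.range c') ∧
      (∀ (X₂ : Scheme.{0}) (π : X₂ ⟶ X₁), IsBlowup π J →
        (∀ x : X₂, π.base x ∈ (J.support : Set X₁) → π.base x ≠ η → ¬ IsClosed ({x} : Set X₂) →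
          IsDomain (X₂.presheaf.stalk x) ∧ ∀ d : ℕ, ringKrullDim (X₂.presheaf.stalk x) = d → ∀ s : Fin d → X₂.presheaf.stalk x,
            (Ideal.span (Set.range s)).radical.IsMaximal → RingTheory.Sequence.IsWeaklyRegular (X₂.presheaf.stalk x) (List.ofFn s) ∧
            ∀ t : X₂.presheaf.stalk x, (∃ e : ℕ, t ^ p ^ e ∈ Ideal.span ((fun z : X₂.presheaf.stalk x => z ^ p ^ e) ''
              (Ideal.span (Set.range s) : Set (X₂.presheaf.stalk x)))) → t ∈ Ideal.span (Set.range s)) ∧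
        (∀ x : X₂, π.base x ∈ (J.support : Set X₁) → IsClosed ({x} : Set X₂) →
          ∀ d : ℕ, ringKrullDim (X₂.presheaf.stalk x) = d → ∀ s : Fin d → X₂.presheaf.stalk x,
            (Ideal.span (Set.range s)).radical.IsMaximal → RingTheory.Sequence.IsWeaklyRegular (X₂.presheaf.stalk x) (List.ofFn s)))

/-! ## §4 The splitters (door v35 derives v34's three research stubs from these) and the converse weakenings -/

/-- **#4β(dim ≥ 4) ⇐ #4β(dim = 4) + #4β(dim ≥ 5).** [plumbing] -/
theorem closedCentreExistsDimGe4_of_eq4_ge5 (h4 : ClosedCentreExistsDimEq4) (h5 : ClosedCentreExistsDimGe5) :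
    ClosedCentreRungs.ClosedCentreExistsDimGe4 := by
  intro p hp k _ _ X₁ f₁ hs hl hq hi hd
  rcases dim_eq4_or_ge5 _ hd with h | h
  · exact h4 p hp k X₁ f₁ hs hl hq hi h
  · exact h5 p hp k X₁ f₁ hs hl hq hi h

/-- **FC″(loc dim ≤ 3, dim ≥ 4) ⇐ its dim = 4 and dim ≥ 5 slices.** [plumbing] -/
theorem fcUnguardedLocDimLe3_of_eq4_ge5 (h4 : FCUnguardedLocDimLe3DimEq4) (h5 : FCUnguardedLocDimLe3DimGe5) :
    FCUnguardedLocDimLe3.FCUnguardedLocDimLe3 := by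
  intro p hp k _ _ X₁ f₁ hs hl hq hi hd
  rcases dim_eq4_or_ge5 _ hd with h | h
  · exact h4 p hp k X₁ f₁ hs hl hq hi h
  · exact h5 p hp k X₁ f₁ hs hl hq hi h

/-- **FC″(loc dim ≥ 4, dim ≥ 4) ⇐ its dim ≥ 5 slice** — in dimension `4` the hypothesis `4 ≤ dim 𝒪_η` forces `η` closed
(`FCUnguardedDimFourOfAbsorbingStep.isClosed_singleton_of_le_ringKrullDim_stalk`), contradicting `¬ IsClosed {η}`. [plumbing] -/
theorem fcUnguardedLocDimGe4_of_ge5 (h5 : FCUnguardedLocDimGe4DimGe5) : FCUnguardedAprime.FCUnguardedLocDimGe4 := by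
  intro p hp k _ _ X₁ f₁ hs hl hq hi hd hCM η hη hη4
  rcases dim_eq4_or_ge5 _ hd with h | h
  · exact absurd (FCUnguardedDimFourOfAbsorbingStep.isClosed_singleton_of_le_ringKrullDim_stalk (n := 4) h.le hη4) hη.1
  · exact h5 p hp k X₁ f₁ hs hl hq hi h hCM η hη hη4

/-- Sanity: the new statements are weakenings of their v34 parents (an honest case split). [plumbing] -/
theorem splits_of_dimGe4 (hC : ClosedCentreRungs.ClosedCentreExistsDimGe4) (hF : FCUnguardedLocDimLe3.FCUnguardedLocDimLe3)
    (hG4 : FCUnguardedAprime.FCUnguardedLocDimGe4) :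
    ClosedCentreExistsDimEq4 ∧ ClosedCentreExistsDimGe5 ∧ FCUnguardedLocDimLe3DimEq4 ∧ FCUnguardedLocDimLe3DimGe5 ∧ FCUnguardedLocDimGe4DimGe5 :=
  ⟨fun p hp k _ _ X₁ f₁ hs hl hq hi hd => hC p hp k X₁ f₁ hs hl hq hi (four_le_of_eq4 hd),
    fun p hp k _ _ X₁ f₁ hs hl hq hi hd => hC p hp k X₁ f₁ hs hl hq hi (four_le_of_five_le hd),
    fun p hp k _ _ X₁ f₁ hs hl hq hi hd => hF p hp k X₁ f₁ hs hl hq hi (four_le_of_eq4 hd),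
    fun p hp k _ _ X₁ f₁ hs hl hq hi hd => hF p hp k X₁ f₁ hs hl hq hi (four_le_of_five_le hd),
    fun p hp k _ _ X₁ f₁ hs hl hq hi hd => hG4 p hp k X₁ f₁ hs hl hq hi (four_le_of_five_le hd)⟩

end Summit.ResolutionOfSingularities.ResolutionOfSingularities.Theorems.FInjectiveMacaulayfication.DimSplitFive

end
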